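import Literature.Barriers.CriticalPhenomena.LaceExpansionPcSubcritCoefficients
import Mathlib.Analysis.SpecialFunctions.Trigonometric.Sinc
import HarnessLib

/-!
# `Hara2008_prop12Subcrit` from uniform subcritical diagrammatic bounds on `Π^{(N)}_p`
# (Heydenreich–van der Hofstad, Cor. 8.13 and Lemma 8.4; Hara 2008, Prop. 1.2 / Appendix A)

Barrier catalogue `Literature/Barriers/CriticalPhenomena/` (D-0021); a proof file, companion of
`LaceExpansionPcSubcritCoefficients.lean` (the bridge `isLaceCoefficientAt_lacePiSum`:
`Π_p = Σ_N (-1)^N Π^{(N)}_p` IS a lace coefficient below `p_c` as soon as `Σ_NΣ_x Π^{(N)}_p < ∞`).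
Here the remaining three clauses of the named fact `Hara2008_prop12Subcrit`
(`LaceExpansionPcSubcrit.lean`) — the `p`-independent summable majorant `|Π_p(x)| ≤ h(x)`, the
uniform second moment `Σ_x |x|²|Π_p(x)| ≤ C`, and the infrared lower bound
`c₁|k|²/d ≤ Ĵ_p(0) - Ĵ_p(k)` near `p_c` — are derived from bounds on the coefficients `Π^{(N)}_p`
of the shape the diagrammatic estimates deliver (Heydenreich–van der Hofstad Prop. 7.4 /
Lemma 8.4: `Σ_x Π^{(N)}_p(x) ≤ …`, `Σ_x [1 - cos(k·x)] Π^{(N)}_p(x) ≤ … [1 - D̂(k)]`, uniformly in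
`p < p_c`), so that the fact is REDUCED to those estimates with `p`-uniform constants:

* `two_mul_one_sub_cos` — `2(1 - cos u) = u² sinc²(u/2)`;
* `summable_sq_mul_of_one_sub_cos` — THE SECOND-MOMENT LEMMA: for `F ≥ 0` on `ℤ^d`, if
  `Σ_x [1 - cos(t x_j)] F(x) ≤ C [1 - cos t]` for `0 < t ≤ 1`, then `Σ_x x_j² F(x) ≤ C` (finite
  partial sums, `t → 0⁺`; this is how `Σ_x|x|²|Π_p(x)| < ∞` — Hara's (1.17) — follows from the
  `k`-space bound (8.3.2)/(8.3.6) `Σ_x [1 - cos(k·x)] |Π_p(x)| ≤ c [1 - D̂(k)]` at `k = t e_j`);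
* `one_sub_Dhat_single` — `1 - D̂(t e_j) = [1 - cos t]/d`;
* `laceKernel_infraredLower` — THE INFRARED LOWER BOUND from smallness: for symmetric `Φ ∈ ℓ¹`
  with `Σ_x|Φ| ≤ A`, `Σ_x[1 - cos(k·x)]|Φ(x)| ≤ B[1 - D̂(k)]` and `A + B ≤ 1`, Hara's kernel
  `J = 2dp D ⋆ (δ₀ + Φ)` obeys `Ĵ(0) - Re Ĵ(k) ≥ 2dp(1 - A - B)(2/π²)|k|²/d` on `[-π,π]^d`
  (`Ĵ = 2dpD̂(1 + Φ̂)`, (6.1.3), and `1 - D̂(k) ≥ (2/π²)|k|²/d`, (5.1.11));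
* `Hara2008_prop12Subcrit_of_subcritEnvelopeBounds` — THE REDUCTION (envelope form): if for every
  `d ≥ 11` there are a summable `p`-independent majorant `Σ_N Π^{(N)}_p(x) ≤ h(x)` (`p < p_c`, the
  expansion converging), a constant `B` with `Σ_x[1 - cos(k·x)]Σ_NΠ^{(N)}_p(x) ≤ B[1 - D̂(k)]` on
  the cube (`p < p_c`), smallness `Σ_x h(x) + B < 1` and some `0 < p₀ < p_c`, then
  `Hara2008_prop12Subcrit` holds — with `Φ_p = lacePiSum d p` the Hara–Slade coefficient, the
  majorant `h`, `C = B`, `c₁ = 2dp₀(1 - Σh - B)·2/π²`;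
* `Hara2008_prop12Subcrit_of_subcritDiagramBounds` — the same from per-`N` bounds
  `Π^{(N)}_p(x) ≤ D_N(x)`, `Σ_x[1 - cos(k·x)]Π^{(N)}_p(x) ≤ b_N[1 - D̂(k)]` with `Σ_{N,x} D_N(x) +
  Σ_N b_N < 1` (Tonelli over `N`, `tsum_one_sub_cos_mul_envelope_le`).

What is NOT proved here (the content left in `Hara2008_prop12Subcrit` after this reduction): the
diagrammatic estimates themselves with `p`-uniform constants and their smallness for `d ≥ 11` —
Heydenreich–van der Hofstad Prop. 7.4 (`HvdH2017_prop74`) in pointwise `x`-space form, the bounds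
on the triangle, `W_p` and `H_p` diagrams uniformly in `p < p_c`, and, for `11 ≤ d`, the
computer-assisted input of Fitzner–van der Hofstad 2017 (`FitznerVanDerHofstad2017_infraredBound`).

## References

* M. Heydenreich, R. van der Hofstad, *Progress in High-Dimensional Percolation and Random
  Graphs* (Springer 2017): (5.1.11), (6.1.2)–(6.1.3), (6.3.3), Prop. 7.4, Prop. 8.3
  ((8.3.1)–(8.3.2)), Lemma 8.4 ((8.3.5)–(8.3.6)), Cor. 8.13 ((8.5.1)–(8.5.2)) and its proof.
* T. Hara, Ann. Probab. 36 (2008) 530–593: Prop. 1.2 ((1.16)–(1.17): `0 ≤ Π^{(n)}_p ≤ h^{(n)}`,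
  `Σ_x|x|²|Π_p(x)| ≤ c/d`, `c₁|k|²/d ≤ Ĵ_p(0) - Ĵ_p(k)`), Appendix A (items 1–2).
-/

noncomputable section

namespace Literature.Barriers.CriticalPhenomena

open _root_.MeasureTheory _root_.Filter _root_.Topology Literature.Probability.LatticeModels
  Literature.Probability.Percolation
open SpreadOutIsing (delta0 latticeConv)
open scoped BigOperators ENNReal

variable {d : ℕ}

/-! ### 1. Second moments from `[1 - cos]` bounds -/

/-- `2(1 - cos u) = u² sinc²(u/2)` (`1 - cos u = 2 sin²(u/2)`). [folklore] -/
theorem two_mul_one_sub_cos (u : ℝ) : 2 * (1 - Real.cos u) = u ^ 2 * Real.sinc (u / 2) ^ 2 := by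
  rcases eq_or_ne u 0 with rfl | hu
  · simp
  · have hu2 : u / 2 ≠ 0 := div_ne_zero hu two_ne_zero
    rw [Real.sinc_of_ne_zero hu2]
    have hcos : Real.cos u = 2 * Real.cos (u / 2) ^ 2 - 1 := by
      rw [← Real.cos_two_mul]; congr 1; ring
    have hsin : Real.sin (u / 2) ^ 2 = 1 - Real.cos (u / 2) ^ 2 := Real.sin_sq _
    rw [div_pow, hsin, hcos]
    field_simp
    ring

/-- **The second-moment lemma.** For `F ≥ 0` on `ℤ^d` and a coordinate `j`: if
`Σ_x [1 - cos(t x_j)] F(x) ≤ C [1 - cos t]` for all `0 < t ≤ 1`, then `x ↦ x_j² F(x)` is summable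
and `Σ_x x_j² F(x) ≤ C`. (For a finite set `S`, `Σ_{x∈S} x_j² sinc²(t x_j/2) F(x) =
t⁻² Σ_{x∈S} 2[1 - cos(t x_j)] F(x) ≤ C sinc²(t/2)`; let `t → 0⁺`.) This is the passage from the
`k`-space bound `Σ_x[1 - cos(k·x)]|Π_p(x)| ≤ c[1 - D̂(k)]` ((8.3.2)) to Hara's
`Σ_x |x|²|Π_p(x)| ≤ c/d` ((1.17)). [cite: HeydenreichVanDerHofstad2017, (8.3.2)] [cite: Hara2008, Prop. 1.2 ((1.17))] -/
theorem summable_sq_mul_of_one_sub_cos {F : Site d → ℝ} (hF0 : ∀ x, 0 ≤ F x) (j : Fin d) {C : ℝ}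
    (h : ∀ t : ℝ, 0 < t → t ≤ 1 →
      (Summable fun x : Site d => (1 - Real.cos (t * ((x j : ℤ) : ℝ))) * F x) ∧
        ∑' x : Site d, (1 - Real.cos (t * ((x j : ℤ) : ℝ))) * F x ≤ C * (1 - Real.cos t)) :
    (Summable fun x : Site d => ((x j : ℤ) : ℝ) ^ 2 * F x) ∧
      ∑' x : Site d, ((x j : ℤ) : ℝ) ^ 2 * F x ≤ C := by
  have hfin : ∀ S : Finset (Site d), ∑ x ∈ S, ((x j : ℤ) : ℝ) ^ 2 * F x ≤ C := by
    intro S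
    set φ : ℝ → ℝ := fun t =>
      ∑ x ∈ S, ((x j : ℤ) : ℝ) ^ 2 * Real.sinc (t * ((x j : ℤ) : ℝ) / 2) ^ 2 * F x with hφ
    have hφc : Continuous φ := by
      refine continuous_finsetSum _ fun x _ => ?_
      exact (continuous_const.mul ((Real.continuous_sinc.comp
        ((continuous_id.mul continuous_const).div_const _)).pow 2)).mul continuous_const
    have hφ0 : φ 0 = ∑ x ∈ S, ((x j : ℤ) : ℝ) ^ 2 * F x := by
      simp [hφ, Real.sinc_zero]
    -- `φ(t) ≤ C sinc²(t/2)` for `0 < t ≤ 1`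
    have hφle : ∀ t, 0 < t → t ≤ 1 → φ t ≤ C * Real.sinc (t / 2) ^ 2 := by
      intro t ht0 ht1
      obtain ⟨hs, hle⟩ := h t ht0 ht1
      have ht2 : (0 : ℝ) < t ^ 2 := by positivity
      have h1 : t ^ 2 * φ t = ∑ x ∈ S, 2 * (1 - Real.cos (t * ((x j : ℤ) : ℝ))) * F x := by
        rw [hφ, Finset.mul_sum]
        refine Finset.sum_congr rfl fun x _ => ?_
        rw [two_mul_one_sub_cos (t * ((x j : ℤ) : ℝ))]
        ring
      have h2 : ∑ x ∈ S, 2 * (1 - Real.cos (t * ((x j : ℤ) : ℝ))) * F x ≤ 2 * (C * (1 - Real.cos t)) := by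
        have : ∑ x ∈ S, 2 * (1 - Real.cos (t * ((x j : ℤ) : ℝ))) * F x =
            2 * ∑ x ∈ S, (1 - Real.cos (t * ((x j : ℤ) : ℝ))) * F x := by
          rw [Finset.mul_sum]
          exact Finset.sum_congr rfl fun x _ => by ring
        rw [this]
        refine mul_le_mul_of_nonneg_left ((hs.sum_le_tsum S fun x _ => ?_).trans hle) (by norm_num)
        exact mul_nonneg (sub_nonneg.2 (Real.cos_le_one _)) (hF0 x)
      have h3 : 2 * (C * (1 - Real.cos t)) = t ^ 2 * (C * Real.sinc (t / 2) ^ 2) := by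
        have := two_mul_one_sub_cos t
        linear_combination C * this
      have h4 : t ^ 2 * φ t ≤ t ^ 2 * (C * Real.sinc (t / 2) ^ 2) := by
        rw [h1, ← h3]; exact h2
      exact le_of_mul_le_mul_left h4 ht2
    -- `t → 0⁺`
    have hlimφ : Tendsto φ (𝓝[>] 0) (𝓝 (∑ x ∈ S, ((x j : ℤ) : ℝ) ^ 2 * F x)) := by
      rw [← hφ0]; exact hφc.continuousAt.tendsto.mono_left nhdsWithin_le_nhds
    have hlimC : Tendsto (fun t : ℝ => C * Real.sinc (t / 2) ^ 2) (𝓝[>] 0) (𝓝 C) := by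
      have hc : Continuous fun t : ℝ => C * Real.sinc (t / 2) ^ 2 :=
        continuous_const.mul ((Real.continuous_sinc.comp (continuous_id.div_const _)).pow 2)
      have := hc.continuousAt (x := 0) |>.tendsto
      simp only [zero_div, Real.sinc_zero, one_pow, mul_one] at this
      exact this.mono_left nhdsWithin_le_nhds
    have hev : ∀ᶠ t in 𝓝[>] (0 : ℝ), φ t ≤ C * Real.sinc (t / 2) ^ 2 := by
      filter_upwards [Ioc_mem_nhdsGT (zero_lt_one' ℝ)] with t ht
      exact hφle t ht.1 ht.2
    exact le_of_tendsto_of_tendsto hlimφ hlimC hev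
  have h0 : ∀ x : Site d, 0 ≤ ((x j : ℤ) : ℝ) ^ 2 * F x := fun x => mul_nonneg (sq_nonneg _) (hF0 x)
  exact ⟨summable_of_sum_le h0 hfin, Real.tsum_le_of_sum_le h0 hfin⟩

/-- `1 - D̂(t e_j) = [1 - cos t]/d` (`d ≥ 1`). [cite: HeydenreichVanDerHofstad2017, (2.2.13)] -/
theorem one_sub_Dhat_single [NeZero d] (j : Fin d) (t : ℝ) :
    1 - Dhat d (Pi.single j t) = (1 - Real.cos t) / d := by
  rw [one_sub_Dhat]
  congr 1
  rw [Finset.sum_eq_single j]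
  · simp
  · intro i _ hij
    simp [Pi.single_eq_of_ne hij]
  · intro hj; exact absurd (Finset.mem_univ j) hj

/-- **Second moments of a coefficient envelope from its `k`-space bound.** If `F ≥ 0` satisfies
`Σ_x [1 - cos(k·x)] F(x) ≤ B [1 - D̂(k)]` (with summability) for every `k ∈ [-π,π]^d`, `d ≥ 1`,
then `Σ_x |x|² F(x) ≤ B` (and the family is summable): apply `summable_sq_mul_of_one_sub_cos`
at `k = t e_j` (`k·x = t x_j`, `1 - D̂(t e_j) = [1 - cos t]/d`) and sum over `j`.
[cite: HeydenreichVanDerHofstad2017, (8.3.2)] [cite: Hara2008, Prop. 1.2 ((1.17))] -/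
theorem summable_euclidNorm_sq_mul_of_kspace (hd : 1 ≤ d) {F : Site d → ℝ} (hF0 : ∀ x, 0 ≤ F x)
    {B : ℝ}
    (h : ∀ k ∈ cube d, (Summable fun x : Site d => (1 - Real.cos (kdot k x)) * F x) ∧
      ∑' x : Site d, (1 - Real.cos (kdot k x)) * F x ≤ B * (1 - Dhat d k)) :
    (Summable fun x : Site d => euclidNorm x ^ 2 * F x) ∧
      ∑' x : Site d, euclidNorm x ^ 2 * F x ≤ B := by
  haveI : NeZero d := ⟨by omega⟩
  have hdpos : (0 : ℝ) < d := by exact_mod_cast (show 0 < d by omega)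
  -- coordinatewise
  have hj : ∀ j : Fin d, (Summable fun x : Site d => ((x j : ℤ) : ℝ) ^ 2 * F x) ∧
      ∑' x : Site d, ((x j : ℤ) : ℝ) ^ 2 * F x ≤ B / d := by
    intro j
    refine summable_sq_mul_of_one_sub_cos hF0 j fun t ht0 ht1 => ?_
    have htπ : |t| ≤ Real.pi := by
      rw [abs_of_pos ht0]; linarith [Real.pi_gt_three]
    obtain ⟨hs, hle⟩ := h (Pi.single j t) (single_mem_cube j htπ)
    simp only [kdot_single] at hs hle
    rw [one_sub_Dhat_single] at hle
    refine ⟨hs, hle.trans_eq ?_⟩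
    field_simp
  -- sum over `j`
  have hsum : ∀ x : Site d, euclidNorm x ^ 2 * F x = ∑ j, ((x j : ℤ) : ℝ) ^ 2 * F x := fun x => by
    rw [euclidNorm_sq, Finset.sum_mul]
  have hS : Summable fun x : Site d => euclidNorm x ^ 2 * F x := by
    refine (summable_sum fun j (_ : j ∈ Finset.univ) => (hj j).1).congr fun x => (hsum x).symm
  refine ⟨hS, ?_⟩
  calc ∑' x : Site d, euclidNorm x ^ 2 * F x = ∑' x : Site d, ∑ j, ((x j : ℤ) : ℝ) ^ 2 * F x :=
        tsum_congr hsum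
    _ = ∑ j, ∑' x : Site d, ((x j : ℤ) : ℝ) ^ 2 * F x := Summable.tsum_finsetSum fun j _ => (hj j).1
    _ ≤ ∑ _j : Fin d, B / d := Finset.sum_le_sum fun j _ => (hj j).2
    _ = B := by
        rw [Finset.sum_const, Finset.card_univ, Fintype.card_fin, nsmul_eq_mul]
        field_simp

/-! ### 2. The infrared lower bound from smallness -/

/-- `g = δ₀ + Φ` is symmetric under `x ↦ -x` when `Φ` is. [folklore] -/
theorem laceSource_neg {Φ : Site d → ℝ} (hΦs : ∀ x, Φ (-x) = Φ x) (x : Site d) :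
    laceSource Φ (-x) = laceSource Φ x := by
  simp only [laceSource, neg_eq_zero, hΦs]

/-- `g = δ₀ + Φ` is summable when `Φ` is. [folklore] -/
theorem summable_laceSource {Φ : Site d → ℝ} (hΦ : Summable Φ) : Summable (laceSource Φ) :=
  (hasSum_delta0.summable.add hΦ).congr fun x => (laceSource_eq_delta0_add Φ x).symm

/-- `ĝ(k) = 1 + Φ̂(k)` (cosine transforms). [cite: Hara2008, Prop. 1.2 (ĝ_p = 1 + Π̂_p)] -/
theorem cosFT_laceSource {Φ : Site d → ℝ} (hΦ : Summable Φ) (k : Fin d → ℝ) :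
    cosFT (laceSource Φ) k = 1 + cosFT Φ k := by
  rw [show laceSource Φ = fun x => delta0 x + Φ x from funext fun x => laceSource_eq_delta0_add Φ x,
    cosFT_add hasSum_delta0.summable hΦ, cosFT_delta0]

/-- **`Ĵ(k) = 2dp D̂(k) [1 + Φ̂(k)]`** for Hara's kernel `J = 2dp D ⋆ (δ₀ + Φ)`, `Φ` symmetric and
summable (cosine transforms; `d ≥ 1`). [cite: Hara2008, Prop. 1.2 (Ĵ_p = 2dp D̂ ĝ_p)]
[cite: HeydenreichVanDerHofstad2017, (6.1.3)] -/
theorem cosFT_laceKernel (hd : 1 ≤ d) (p : unitInterval) {Φ : Site d → ℝ} (hΦ : Summable Φ)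
    (hΦs : ∀ x, Φ (-x) = Φ x) (k : Fin d → ℝ) :
    cosFT (laceKernel p Φ) k = 2 * d * (p : ℝ) * Dhat d k * (1 + cosFT Φ k) := by
  haveI : NeZero d := ⟨by omega⟩
  rw [show laceKernel (p : ℝ) Φ = latticeConv (bondJ d p) (laceSource Φ) from
    funext fun y => laceKernel_eq_latticeConv p Φ y,
    cosFT_latticeConv (summable_bondJ hd p) (summable_laceSource hΦ) (laceSource_neg hΦs),
    cosFT_bondJ, cosFT_laceSource hΦ]

/-- `Re Ĵ(k)` (the complex lattice Fourier transform of `LaceExpansionXSpaceAsymptotics.lean`) is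
the cosine transform `cosFT J k`. [folklore] -/
theorem re_latticeFT_eq_cosFT {J : Site d → ℝ} (hJ : Summable fun x => |J x|) (k : Fin d → ℝ) :
    (latticeFT J k).re = cosFT J k := by
  rw [re_latticeFT hJ, cosFT]
  exact tsum_congr fun x => mul_comm _ _

/-- **The infrared lower bound from smallness of `Π`.** Let `d ≥ 1`, `Φ ∈ ℓ¹(ℤ^d)` symmetric,
`Σ_x |Φ(x)| ≤ A`, `Σ_x [1 - cos(k·x)] |Φ(x)| ≤ B [1 - D̂(k)]` on `[-π,π]^d` and `A + B ≤ 1`. Then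
Hara's kernel `J = 2dp D ⋆ (δ₀ + Φ)` satisfies, for `k ∈ [-π,π]^d`,
`Ĵ(0) - Re Ĵ(k) ≥ 2dp (1 - A - B) · (2/π²)|k|²/d`: indeed
`Ĵ(0) - Ĵ(k) = 2dp{[1 - D̂(k)][1 + Φ̂(k)] + [Φ̂(0) - Φ̂(k)]}`, `1 + Φ̂(k) ≥ 1 - A`,
`|Φ̂(0) - Φ̂(k)| ≤ B[1 - D̂(k)]`, and `1 - D̂(k) ≥ (2/π²)|k|²/d` ((5.1.11)).
[cite: Hara2008, Prop. 1.2 (c₁|k|²/d ≤ Ĵ_p(0) - Ĵ_p(k))]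
[cite: HeydenreichVanDerHofstad2017, (6.1.3), (8.3.1)–(8.3.2) and (5.1.11)] -/
theorem laceKernel_infraredLower (hd : 1 ≤ d) (p : unitInterval) {Φ : Site d → ℝ}
    (hΦ : Summable fun x => |Φ x|) (hΦs : ∀ x, Φ (-x) = Φ x) {A B : ℝ}
    (hA : ∑' x, |Φ x| ≤ A)
    (hB : ∀ k ∈ cube d, ∑' x, (1 - Real.cos (kdot k x)) * |Φ x| ≤ B * (1 - Dhat d k))
    (hAB : A + B ≤ 1) {k : Fin d → ℝ} (hk : k ∈ cube d) :
    2 * d * (p : ℝ) * (1 - A - B) * (2 / Real.pi ^ 2 * (∑ j, k j ^ 2) / d) ≤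
      (∑' y, laceKernel p Φ y) - (latticeFT (laceKernel p Φ) k).re := by
  haveI : NeZero d := ⟨by omega⟩
  have hΦ' : Summable Φ := hΦ.of_abs
  rw [re_latticeFT_eq_cosFT (summable_abs_laceKernel hΦ p), ← cosFT_zero, cosFT_laceKernel hd p hΦ' hΦs,
    cosFT_laceKernel hd p hΦ' hΦs, Dhat_zero]
  have hq0 : (0 : ℝ) ≤ 2 * d * (p : ℝ) := by have := p.2.1; positivity
  have hDk : 0 ≤ 1 - Dhat d k := one_sub_Dhat_nonneg k
  have hk' : ∀ j, k j ∈ Set.Icc (-Real.pi) Real.pi := fun j => Set.mem_univ_pi.1 hk j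
  have h511 : 2 / Real.pi ^ 2 * (∑ j, k j ^ 2) / d ≤ 1 - Dhat d k := HvdH_5_1_11 hk'
  -- `1 + Φ̂(k) ≥ 1 - A`
  have h1 : 1 - A ≤ 1 + cosFT Φ k := by
    have := abs_cosFT_le hΦ' k
    have := neg_abs_le (cosFT Φ k)
    linarith
  -- `Φ̂(0) - Φ̂(k) ≥ -B(1 - D̂ k)`
  have h2 : -(B * (1 - Dhat d k)) ≤ cosFT Φ 0 - cosFT Φ k := by
    have := abs_cosFT_zero_sub_le hΦ' k
    have := neg_abs_le (cosFT Φ 0 - cosFT Φ k)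
    linarith [hB k hk]
  have h3 : (1 - A - B) * (1 - Dhat d k) ≤
      1 * (1 + cosFT Φ 0) - Dhat d k * (1 + cosFT Φ k) := by
    have e : 1 * (1 + cosFT Φ 0) - Dhat d k * (1 + cosFT Φ k) =
        (1 - Dhat d k) * (1 + cosFT Φ k) + (cosFT Φ 0 - cosFT Φ k) := by ring
    rw [e]
    have := mul_le_mul_of_nonneg_left h1 hDk
    nlinarith
  have hsq : 0 ≤ 2 / Real.pi ^ 2 * (∑ j, k j ^ 2) / d := by positivity
  rcases le_or_gt 0 (1 - A - B) with hpos | hneg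
  · calc 2 * d * (p : ℝ) * (1 - A - B) * (2 / Real.pi ^ 2 * (∑ j, k j ^ 2) / d)
        ≤ 2 * d * (p : ℝ) * (1 - A - B) * (1 - Dhat d k) :=
          mul_le_mul_of_nonneg_left h511 (mul_nonneg hq0 hpos)
      _ = 2 * d * (p : ℝ) * ((1 - A - B) * (1 - Dhat d k)) := by ring
      _ ≤ 2 * d * (p : ℝ) * (1 * (1 + cosFT Φ 0) - Dhat d k * (1 + cosFT Φ k)) :=
          mul_le_mul_of_nonneg_left h3 hq0
      _ = _ := by ring
  · exfalso; linarith

/-! ### 3. The reduction of `Hara2008_prop12Subcrit` to uniform subcritical bounds -/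

/-- **The weighted envelope bound** (Tonelli over `N`): from
`Σ_x[1 - cos(k·x)]Π^{(N)}_p(x) ≤ b_N[1 - D̂(k)]` with `Σ_N b_N = B`, the envelope
`G = Σ_N Π^{(N)}_p` obeys `Σ_x[1 - cos(k·x)]G(x) ≤ B[1 - D̂(k)]` (with summability).
[cite: HeydenreichVanDerHofstad2017, (8.3.2) from (8.3.6)] -/
theorem tsum_one_sub_cos_mul_envelope_le {p : unitInterval} {b : ℕ → ℝ} (hb : Summable b)
    (k : Fin d → ℝ)
    (h : ∀ N, (Summable fun x => (1 - Real.cos (kdot k x)) * lacePi d p N x) ∧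
      ∑' x, (1 - Real.cos (kdot k x)) * lacePi d p N x ≤ b N * (1 - Dhat d k)) :
    (Summable fun x => (1 - Real.cos (kdot k x)) * ∑' N, lacePi d p N x) ∧
      ∑' x, (1 - Real.cos (kdot k x)) * (∑' N, lacePi d p N x) ≤ (∑' N, b N) * (1 - Dhat d k) := by
  have hw0 : ∀ x : Site d, 0 ≤ 1 - Real.cos (kdot k x) := fun x => sub_nonneg.2 (Real.cos_le_one _)
  obtain ⟨hWs, -, hWle⟩ := tonelli_nat_site (F := fun N x => (1 - Real.cos (kdot k x)) * lacePi d p N x)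
    (fun N x => mul_nonneg (hw0 x) (lacePi_nonneg p N x)) (fun N => (h N).1)
    (hb.mul_right (1 - Dhat d k)) (fun N => (h N).2)
  have hpt : ∀ x, ∑' N, (1 - Real.cos (kdot k x)) * lacePi d p N x =
      (1 - Real.cos (kdot k x)) * ∑' N, lacePi d p N x := fun x => tsum_mul_left
  refine ⟨hWs.congr hpt, ?_⟩
  calc ∑' x, (1 - Real.cos (kdot k x)) * (∑' N, lacePi d p N x)
      = ∑' x, ∑' N, (1 - Real.cos (kdot k x)) * lacePi d p N x := tsum_congr fun x => (hpt x).symm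
    _ ≤ ∑' N, b N * (1 - Dhat d k) := hWle
    _ = (∑' N, b N) * (1 - Dhat d k) := tsum_mul_right

/-- **`Hara2008_prop12Subcrit` from uniform subcritical bounds on the envelope `G_p = Σ_N Π^{(N)}_p`.**
Suppose that for every `d ≥ 11` there are a summable `h : ℤ^d → ℝ`, a constant `B` and `p₀` with
`0 < p₀ < p_c` and the smallness `Σ_x h(x) + B < 1`, such that for every `p < p_c`: the expansion
converges (`Σ_NΣ_x Π^{(N)}_p(x) < ∞`), `G_p(x) = Σ_N Π^{(N)}_p(x) ≤ h(x)` (a `p`-independent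
majorant) and `Σ_x [1 - cos(k·x)] G_p(x) ≤ B [1 - D̂(k)]` on `[-π,π]^d` (with summability). Then
`Hara2008_prop12Subcrit` holds, with the Hara–Slade coefficients `Φ_p = Π_p = lacePiSum d p`
(clause (i) by `isLaceCoefficientAt_lacePiSum`), the majorant `h` (clause (ii), `|Π_p| ≤ G_p ≤ h`),
`C = B` (clause (iii) by `summable_euclidNorm_sq_mul_of_kspace`) and
`c₁ = 2dp₀(1 - Σh - B)(2/π²)` (clause (iv) by `laceKernel_infraredLower`). The hypothesis is the
`p`-uniform output of the diagrammatic estimates summed over `N` ((8.3.1)–(8.3.2) and Cor. 8.13: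
"the bounds … hold uniformly in `p < p_c`"; Hara (1.16): "`0 ≤ Π^{(n)}_p ≤ h^{(n)}` … `h^{(n)}`
independent of `p`").
[cite: HeydenreichVanDerHofstad2017, Prop. 8.3 ((8.3.1)–(8.3.2)) and Cor. 8.13 ((8.5.1)–(8.5.2))]
[cite: Hara2008, Prop. 1.2 ((1.16)–(1.17)) and Appendix A (items 1–2)] -/
theorem Hara2008_prop12Subcrit_of_subcritEnvelopeBounds
    (H : ∀ d : ℕ, 11 ≤ d → ∃ (h : Site d → ℝ) (B : ℝ) (p₀ : unitInterval),
      Summable h ∧ p₀ < criticalProbI d ∧ 0 < (p₀ : ℝ) ∧ (∑' x, h x) + B < 1 ∧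
      ∀ p : unitInterval, p < criticalProbI d →
        Summable (Function.uncurry (lacePi d p)) ∧
        (∀ x, ∑' N, lacePi d p N x ≤ h x) ∧
        (∀ k ∈ cube d, (Summable fun x => (1 - Real.cos (kdot k x)) * ∑' N, lacePi d p N x) ∧
          ∑' x, (1 - Real.cos (kdot k x)) * (∑' N, lacePi d p N x) ≤ B * (1 - Dhat d k))) :
    Hara2008_prop12Subcrit := by
  intro d hd
  obtain ⟨h, B, p₀, hh, hp₀, hp₀0, hsmall, HP⟩ := H d hd
  have hd1 : 1 ≤ d := by omega
  have hd2 : 2 ≤ d := by omega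
  set A : ℝ := ∑' x, h x with hAdef
  have hfam : ∀ p : unitInterval, p < criticalProbI d → Summable (Function.uncurry (lacePi d p)) :=
    fun p hp => (HP p hp).1
  have hΦle : ∀ p : unitInterval, p < criticalProbI d → ∀ x, |lacePiSum d p x| ≤ h x :=
    fun p hp x => (abs_lacePiSum_le (hfam p hp) x).trans ((HP p hp).2.1 x)
  have hW : ∀ p : unitInterval, p < criticalProbI d → ∀ k ∈ cube d,
      (Summable fun x => (1 - Real.cos (kdot k x)) * ∑' N, lacePi d p N x) ∧
        ∑' x, (1 - Real.cos (kdot k x)) * (∑' N, lacePi d p N x) ≤ B * (1 - Dhat d k) :=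
    fun p hp => (HP p hp).2.2
  refine ⟨fun p => lacePiSum d p, h, 2 * d * (p₀ : ℝ) * (1 - A - B) * (2 / Real.pi ^ 2), B, p₀, hh,
    ?_, hp₀, fun p hp => ?_, fun p hp₀p hp k hk => ?_⟩
  · -- `c₁ > 0`
    have : 0 < 1 - A - B := by linarith
    positivity
  · -- clauses (i)–(iii) at `p < p_c`
    have hG0 : ∀ x, 0 ≤ ∑' N, lacePi d p N x := fun x => tsum_nonneg fun N => lacePi_nonneg p N x
    obtain ⟨hS2, hle2⟩ := summable_euclidNorm_sq_mul_of_kspace hd1 hG0 (hW p hp)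
    have hdom : ∀ x, euclidNorm x ^ 2 * |lacePiSum d p x| ≤ euclidNorm x ^ 2 * ∑' N, lacePi d p N x :=
      fun x => mul_le_mul_of_nonneg_left (abs_lacePiSum_le (hfam p hp) x) (sq_nonneg _)
    have hS2' : Summable fun x => euclidNorm x ^ 2 * |lacePiSum d p x| :=
      Summable.of_nonneg_of_le (fun x => mul_nonneg (sq_nonneg _) (abs_nonneg _)) hdom hS2
    exact ⟨isLaceCoefficientAt_lacePiSum hd2 hp (hfam p hp), hΦle p hp, hS2',
      (hS2'.tsum_le_tsum hdom hS2).trans hle2⟩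
  · -- clause (iv) on `[p₀, p_c)`
    have hΦabs : Summable fun x => |lacePiSum d p x| := summable_abs_lacePiSum (hfam p hp)
    have hA' : ∑' x, |lacePiSum d p x| ≤ A := hΦabs.tsum_le_tsum (hΦle p hp) hh
    have hB' : ∀ k ∈ cube d, ∑' x, (1 - Real.cos (kdot k x)) * |lacePiSum d p x| ≤ B * (1 - Dhat d k) := by
      intro k hk
      obtain ⟨hWs, hWle⟩ := hW p hp k hk
      have hw0 : ∀ x : Site d, 0 ≤ 1 - Real.cos (kdot k x) := fun x => sub_nonneg.2 (Real.cos_le_one _)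
      have hpt : ∀ x, (1 - Real.cos (kdot k x)) * |lacePiSum d p x| ≤
          (1 - Real.cos (kdot k x)) * ∑' N, lacePi d p N x := fun x =>
        mul_le_mul_of_nonneg_left (abs_lacePiSum_le (hfam p hp) x) (hw0 x)
      exact ((Summable.of_nonneg_of_le (fun x => mul_nonneg (hw0 x) (abs_nonneg _)) hpt hWs).tsum_le_tsum
        hpt hWs).trans hWle
    have hmain := laceKernel_infraredLower hd1 p hΦabs (lacePiSum_neg p) hA' hB' hsmall.le hk
    have hsq : 0 ≤ 2 / Real.pi ^ 2 * (∑ j, k j ^ 2) / d := by positivity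
    have hAB : 0 ≤ 1 - A - B := by linarith
    have hpp : (p₀ : ℝ) ≤ p := by exact_mod_cast hp₀p
    calc 2 * d * (p₀ : ℝ) * (1 - A - B) * (2 / Real.pi ^ 2) * (∑ i, k i ^ 2) / d
        = 2 * d * (p₀ : ℝ) * (1 - A - B) * (2 / Real.pi ^ 2 * (∑ j, k j ^ 2) / d) := by ring
      _ ≤ 2 * d * (p : ℝ) * (1 - A - B) * (2 / Real.pi ^ 2 * (∑ j, k j ^ 2) / d) := by
          have : 2 * d * (p₀ : ℝ) * (1 - A - B) ≤ 2 * d * (p : ℝ) * (1 - A - B) :=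
            mul_le_mul_of_nonneg_right (by nlinarith) hAB
          exact mul_le_mul_of_nonneg_right this hsq
      _ ≤ _ := hmain

/-- **`Hara2008_prop12Subcrit` from uniform subcritical diagrammatic bounds on each `Π^{(N)}_p`.**
Suppose that for every `d ≥ 11` there are `D : ℕ → ℤ^d → ℝ`, `b : ℕ → ℝ` and `p₀` with:
`Σ_{N,x} D_N(x) < ∞`, `Σ_N b_N < ∞`, `0 < p₀ < p_c`, the smallness `Σ_{N,x} D_N(x) + Σ_N b_N < 1`,
and for every `p < p_c` the pointwise `p`-independent majorant `Π^{(N)}_p(x) ≤ D_N(x)` and the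
weighted bounds `Σ_x [1 - cos(k·x)] Π^{(N)}_p(x) ≤ b_N [1 - D̂(k)]` on `[-π,π]^d` (with
summability). Then `Hara2008_prop12Subcrit` holds (`Φ_p = lacePiSum d p`, `h = Σ_N D_N`,
`C = Σ_N b_N`): `Hara2008_prop12Subcrit_of_subcritEnvelopeBounds` after summing over `N`
(Tonelli, `tsum_one_sub_cos_mul_envelope_le`). The hypothesis is the shape of the output of
Prop. 7.4 / Lemma 8.4 with `p`-uniform constants together with Hara's (1.16)
("`0 ≤ Π^{(n)}_p ≤ h^{(n)}`, `Σ_xΣ_n h^{(n)}(x) ≤ c/d`, `h^{(n)}` independent of `p`").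
[cite: HeydenreichVanDerHofstad2017, Lemma 8.4 ((8.3.5)–(8.3.6)) and Cor. 8.13]
[cite: Hara2008, Prop. 1.2 ((1.16)–(1.17)) and Appendix A (items 1–2)] -/
theorem Hara2008_prop12Subcrit_of_subcritDiagramBounds
    (H : ∀ d : ℕ, 11 ≤ d → ∃ (D : ℕ → Site d → ℝ) (b : ℕ → ℝ) (p₀ : unitInterval),
      Summable (Function.uncurry D) ∧ Summable b ∧ p₀ < criticalProbI d ∧ 0 < (p₀ : ℝ) ∧
      (∑' q, Function.uncurry D q) + (∑' N, b N) < 1 ∧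
      ∀ p : unitInterval, p < criticalProbI d →
        (∀ N x, lacePi d p N x ≤ D N x) ∧
        (∀ N, ∀ k ∈ cube d, (Summable fun x => (1 - Real.cos (kdot k x)) * lacePi d p N x) ∧
          ∑' x, (1 - Real.cos (kdot k x)) * lacePi d p N x ≤ b N * (1 - Dhat d k))) :
    Hara2008_prop12Subcrit := by
  refine Hara2008_prop12Subcrit_of_subcritEnvelopeBounds fun d hd => ?_
  obtain ⟨D, b, p₀, hD, hb, hp₀, hp₀0, hsmall, HP⟩ := H d hd
  have hfam : ∀ p : unitInterval, p < criticalProbI d → Summable (Function.uncurry (lacePi d p)) :=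
    fun p hp => Summable.of_nonneg_of_le (fun q => lacePi_nonneg p q.1 q.2)
      (fun q => (HP p hp).1 q.1 q.2) hD
  have hDN : ∀ x, Summable fun N => D N x := fun x => hD.prod_symm.prod_factor x
  have hAeq : ∑' x, ∑' N, D N x = ∑' q, Function.uncurry D q := by
    rw [hD.tsum_prod, hD.tsum_comm]
    rfl
  refine ⟨fun x => ∑' N, D N x, ∑' N, b N, p₀, hD.prod_symm.prod, hp₀, hp₀0, by rw [hAeq]; exact hsmall,
    fun p hp => ⟨hfam p hp, fun x => ?_, fun k hk => ?_⟩⟩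
  · exact (summable_lacePi_nat (hfam p hp) x).tsum_le_tsum (fun N => (HP p hp).1 N x) (hDN x)
  · exact tsum_one_sub_cos_mul_envelope_le hb k fun N => (HP p hp).2 N k hk

end Literature.Barriers.CriticalPhenomena

end
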